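import Summits.QuantumFields.BalabanUV.T4Continuum.Spine.NE1p.DressedRootComposition

/-!
# T⁴ programme, spine estimate NE1′ (node O3b/H2) — THE COMPOSITION FACE OF RECORD FIRES AT THE INTEGER BLOCK SIZE `L = 2`
# (decided deterministic toy; swarm row W18 of `t4/formal/NE1p/LEAVES.md`, typer R-T71 (v) ∕ R-T72 (ii); INTENT HOME/CLAIMS.log
# 2026-08-20T12:45Z)

Cell `pub-balaban`, sub-cell `t4`, BINDER-OWNERS row NE1′, NE1′ formalisation crew `b2b-balaban-t4-ne1p-formalise-*`, seat `…-leaf-05`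
(gen 2; lineage rows S5 `DressedBirthSuppliers` p212423∕p216787, S5c `DressedBirthFirstOrder` p213388, S5d `DressedBirthSuppliersFam`
p213568).  ADDITIVE — imports the owner's N0e `Spine/NE1p/DressedRootComposition` (p217849: the (γ)-route face of record
`dressedStabilityStrict_of_composition`, its §1 deterministic transport leaf and its §3 «cell without `e³`») ONLY; modifies nothing;
no witness row (W1–W17) is imported or copied.

WHY.  Under the dagwriter's RULING Q-NE1p-route (`t4/T4-DAG.md` v28 §8 Q40) the tower face OF RECORD of row NE1′ is the owner's
`DressedRootComposition.dressedStabilityStrict_of_composition : DressedStabilityStrict 𝒯 (L ^ 4)`, whose transport leaf is the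
lineage's DETERMINISTIC END (`transportsFromVar_of_response`; no `wOp`, no measure, no action margin).  Every decided witness in
the tree (W11∕W11r∕S3s …) fires the ALTERNATIVE (α′) face; NO datum exercised N0e §1's deterministic binders `hsl`∕`hrate`∕`hlin`
nor its §3 (at continuation factor `a = 1` the located largeness forces only `1 < L`).  This file decides ONE datum, AT `L = 2`:
* §1 THE DATUM `towerC` [decided toy]: at cutoff `K`, ONE family born at EVERY scale `j ≤ K` (`Birth = Cube = Fin (K+1)`), every
  alive family felt at every later cube; the carried function of generation `(b, b)` at EVERY scale `k ≥ b` is the SAME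
  non-constant linear map `U ↦ gC K b · U` on the complex line (`𝒰 = Dir = F = ℂ`, chart `move U d t = U + t·d`, window
  `closedBall 0 1`, relation `=`) — an IDENTITY value map, `a = 1` —, the fresh-pair defect is `defC k′ k = (1/4)^(k−k′)` (rate
  `(L²)⁻¹`), and the booked size `sizeC K b k = (1/12)·(1/8)^(K−b)·(1/4)^(k−b)` IS the realised response of that function to a
  scale-`k` fresh pair (`linC_eq_response`: ATTAINED WITHOUT SLACK) — a two-rate profile with per-step factor `1/4 = ψ` although
  the function never moves: the contraction is the defect decay read through attainment (row S3t's typing answer, decided).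
* §2 N0e's binders DISCHARGED ONE BY ONE, non-vacuously where it matters: `hsl_C` (a `BirthSlice` of the linear map at EVERY scale,
  SHARP sup `gen = 3·gC`), `hrate_C` (equality), `hlin_C` (attained), `hbirth_C` (births MEET the class with EQUALITY at every
  birth scale), `hcount_C` (non-empty live sets, one family per scale), `hreg_C` (births only — (w5) IDLE on this toy).
* §3 THE END: **`dressedStabilityStrict_towerC : DressedStabilityStrict towerC ((2:ℝ) ^ 4)`** = N0e's face BY NAME, ONE application,
  at `L = 2, a = 1, r = w = c_δ = 1, C = 4, A₀ = 1, c̄ = 0, N₀ = 1, m = 1/2, s̄⁰ = 0, ρ′ = 1/2` (`locOf 2 1 4 0 = 1/2 ≤ ρ′ < 1`,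
  `m·N₀A₀(1−ρ′)⁻¹ = 1 ≤ 1 − s̄⁰` TIGHT, strict product `Λρ₁τ = 16·(1/4)·(1/8) = 1/2`, `cell_at_two`); the headline
  `dressedStability_towerC` and ROOT-B `dressedBudget_towerC` through N0e §3 BY NAME.

HONEST FRAMING (c4).  «The (γ) face OF RECORD fires on ONE decided deterministic datum at the integer `L = 2` — no `e³`, no `wOp`, no
measure, no margin; (w5) idle, gauge quotient trivial (W15's job); nothing of Bałaban's; (VAL-θ) untouched» (here the value map is
the identity and the defect decay is posited toy data; the numerals are the toy's, not Bałaban's `L`).  [folklore] ∕ [decided toy]; 0 sorry; 0 citations; 0 `def … : Prop` (the `def`s below are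
toy DATA).  Headline (c4): «the composition face fires on one decided deterministic datum», never «NE1′ proved».  NE1′ NOT printed,
NOT proved; spine PROVED 0∕9.  Rung (B)+1 on ONE finite four-torus — NOT infinite volume, NOT a mass gap, NOT OS on ℝ⁴, NOT Clay.
HONEST DEPENDENCY: continuum YM on T⁴ ⇐ BetaPertH ∧ nine spine estimates (0/9 proved); BetaPertH ⇐ (D1) ∧ (D4) ∧ CAP+tail; G-an2-4
gates asym, D1 and NE2/3/4.
-/

noncomputable section

namespace Summit.QuantumFields.BalabanUV.T4Continuum.NE1p.DressedCompositionWitness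

open Finset Metric
open scoped BigOperators
open Literature.MathematicalPhysics.QuantumFieldTheory.Balaban1983to89
open Literature.MathematicalPhysics.QuantumFieldTheory.Balaban1983to89.T4TermFormat
open Literature.MathematicalPhysics.QuantumFieldTheory.Balaban1983to89.T4TermFormat.Booking
open Literature.MathematicalPhysics.QuantumFieldTheory.Balaban1983to89.T4TrajectoryComparison
open Literature.MathematicalPhysics.QuantumFieldTheory.Balaban1983to89.T4BirthChartTransport
  (GaugeInvariant BirthSlice RelGauge)
open Summit.QuantumFields.BalabanUV.T4Continuum.T4TrajectoryDensityDressed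
open Summit.QuantumFields.BalabanUV.T4Continuum.NE1p.DressedRoot
open Summit.QuantumFields.BalabanUV.T4Continuum.NE1p.DressedUniformConstants
open Summit.QuantumFields.BalabanUV.T4Continuum.NE1p.DressedRootComposition

/-! ## §1 The datum: one family per scale, a linear carried function that never moves, geometric defects, attained sizes -/

/-- COEFFICIENT of the carried function of the family born at scale `b` (cutoff `K`): `gC K b = (1/12)·(1/8)^(K−b)` — the source
decay `τ = L⁻³ = 1/8` from the birth scale to the unit lattice is in the coefficient [decided toy]. [folklore] -/
def gC (K b : ℕ) : ℝ := (1 / 12 : ℝ) * (1 / 8 : ℝ) ^ (K - b)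

/-- The coefficient is positive. [folklore] -/
theorem gC_pos (K b : ℕ) : 0 < gC K b := by unfold gC; positivity

/-- BOOKED SIZE of the family born at `b`, at scale `k` (cutoff `K`): `(1/12)·(1/8)^(K−b)·(1/4)^(k−b)` = coefficient × the scale-`k`
defect — a two-rate profile with per-step factor `1/4 = (L²)⁻¹` at `L = 2` [decided toy]. [folklore] -/
def sizeC (K b k : ℕ) : ℝ := gC K b * (1 / 4 : ℝ) ^ (k - b)

/-- Booked sizes are positive (the datum is non-degenerate). [folklore] -/
theorem sizeC_pos (K b k : ℕ) : 0 < sizeC K b k := by unfold sizeC; exact mul_pos (gC_pos K b) (by positivity)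

/-- FRESH-PAIR DEFECT of generation `k′` at scale `k`: `(1/4)^(k−k′)` (`c_δ = 1`, rate `(2²)⁻¹`) [decided toy]. [folklore] -/
def defC (k' k : ℕ) : ℝ := (1 / 4 : ℝ) ^ (k - k')

/-- Defects are positive. [folklore] -/
theorem defC_pos (k' k : ℕ) : 0 < defC k' k := by unfold defC; positivity

/-- Defects STRICTLY decrease along the scales (the contraction the booked size inherits). [folklore] -/
theorem defC_succ_lt (k' k : ℕ) (hk : k' ≤ k) : defC k' (k + 1) < defC k' k := by
  unfold defC
  rw [Nat.succ_sub hk, pow_succ]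
  have h : 0 < (1 / 4 : ℝ) ^ (k - k') := by positivity
  nlinarith

/-- THE BOOKING at cutoff `K` [decided toy]: births `Fin (K+1)` (one per scale, `birthScale b = b`), cubes `Fin (K+1)` (one per scale),
every alive family felt at every later cube, sizes `sizeC`; domains, tree lengths, pair strengths trivial.  Nothing of Bałaban's
is modelled. [folklore] -/
def BC (K : ℕ) : T4TermFormat.Booking where
  K := K
  Dom := Fin (K + 1)
  domScale := fun X => X.val
  treeLen := fun _ => 0
  treeLen_nonneg := fun _ => le_rfl
  balSize := fun _ => 0
  Birth := Fin (K + 1)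
  births := Finset.univ
  mem_births := fun b => Finset.mem_univ b
  birthScale := fun b => b.val
  birth_le := fun b => Nat.lt_succ_iff.mp b.isLt
  loc := fun b => b
  loc_scale := fun _ => rfl
  Cube := Fin (K + 1)
  cubes := Finset.univ
  mem_cubes := fun q => Finset.mem_univ q
  cubeScale := fun q => q.val
  cube_le := fun q => Nat.lt_succ_iff.mp q.isLt
  feltAt := fun q => Finset.univ.filter fun b : Fin (K + 1) => b.val ≤ q.val
  felt_birth_le := fun _ _ hb => (Finset.mem_filter.mp hb).2
  size := fun b k => sizeC K b.val k
  size_nonneg := fun b k => (sizeC_pos K b.val k).le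
  pair := fun _ _ _ => 0

/-- THE TRAJECTORY at cutoff `K` [decided toy]: one generation per family (the birth, size `gen b b = 3·gC K b` = the sharp sup of
the carried function on its slice domain), re-linearised size = the booked size; births only (no regeneration). [folklore] -/
def TC (K : ℕ) : Trajectory (BC K) where
  lin := fun b k' k => if k' = b.val then sizeC K b.val k else 0
  lin_nonneg := fun b k' k => by split_ifs <;> [exact (sizeC_pos K b.val k).le; exact le_rfl]
  gen := fun b k' => if k' = b.val then 3 * gC K b.val else 0
  gen_nonneg := fun b k' => by split_ifs <;> [exact (mul_pos (by norm_num) (gC_pos K b.val)).le; exact le_rfl]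
  size_le := fun b k hbk _ => by
    change b.val ≤ k at hbk
    show sizeC K b.val k ≤ ∑ k' ∈ Icc b.val k, (if k' = b.val then sizeC K b.val k else 0)
    rw [Finset.sum_ite_eq' (Icc b.val k) b.val (fun _ => sizeC K b.val k), if_pos (Finset.mem_Icc.mpr ⟨le_rfl, hbk⟩)]

/-- THE TOWER [decided toy]: the datum at every cutoff (one run parameter). [folklore] -/
def towerC : DressedTower Unit where
  B := fun _ K => BC K
  K_eq := fun _ _ => rfl
  T := fun _ K => TC K

/-- THE CARRIED FUNCTION of generation `k′` of family `b` at scale `k` (cutoff `K`) on the complex line [decided toy]: the birth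
generation (`k′ = b`) is the linear map `U ↦ gC K b · U` AT EVERY SCALE (identity value map: the function never moves); later
generations are absent (`0`). [folklore] -/
def FnC (K : ℕ) (b : Fin (K + 1)) (k' : ℕ) (_k : ℕ) (U : ℂ) : ℂ :=
  if k' = b.val then (gC K b.val : ℂ) * U else 0

/-- THE LIVE FAMILIES of any met component at step `k` [decided toy]: every family born at a scale `≤ k` (one per scale — the dressed
budget gate then sums `k+1` genuine envelopes). [folklore] -/
def SC (K k : ℕ) (_b : Fin (K + 1)) : Finset (Fin (K + 1)) :=
  Finset.univ.filter fun f : Fin (K + 1) => f.val ≤ k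

/-- The carried function of the birth generation is NON-CONSTANT at every scale (so the deterministic binders are exercised
non-vacuously at `≥ 2` scales for every family born before the cutoff). [folklore] -/
theorem FnC_nonconst (K : ℕ) (b : Fin (K + 1)) (k : ℕ) : FnC K b b.val k 1 ≠ FnC K b b.val k 0 := by
  unfold FnC
  rw [if_pos rfl, if_pos rfl, mul_one, mul_zero]
  exact_mod_cast (gC_pos K b.val).ne'

/-- The booked size IS the response of the carried function to the scale-`k` fresh pair `(0, defC b k)` — attainment without
slack. [folklore] -/
theorem linC_eq_response (K : ℕ) (b : Fin (K + 1)) (k : ℕ) :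
    sizeC K b.val k = ‖FnC K b b.val k (defC b.val k : ℂ) - FnC K b b.val k 0‖ := by
  unfold FnC
  rw [if_pos rfl, if_pos rfl, mul_zero, sub_zero, norm_mul, Complex.norm_real, Complex.norm_real,
    Real.norm_of_nonneg (gC_pos K b.val).le, Real.norm_of_nonneg (defC_pos b.val k).le]
  rfl

/-- The booked size is EXACTLY the two-rate class of the face at the toy's constants (`A₀ = 1`, `ρ₁ = rhoOneOf (2²)⁻¹ 1 4 0 = 1/4`,
`τ = 2⁻¹^3 = 1/8`) scaled by `1/12`: a frozen (never-moving) function with a geometrically booked size. [folklore] -/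
theorem sizeC_eq_twoRate (K : ℕ) (b : Fin (K + 1)) (k : ℕ) :
    sizeC K b.val k = (1 / 12 : ℝ) * twoRate 1 (rhoOneOf ((2 : ℝ) ^ 2)⁻¹ 1 (4 * 1 / 1) 0) ((2 : ℝ)⁻¹ ^ 3) K b.val k := by
  unfold sizeC gC twoRate rhoOneOf
  norm_num
  ring

/-! ## §2 The binders of the composition face, discharged on the datum -/

/-- (F-1′ ∕ (VAL-θ)-lite slot) `hsl` NON-VACUOUSLY: at EVERY scale `k ≥ k′` the carried function has a `BirthSlice` along the affine
chart of the complex line, window `1`, radius `1`, regular set `closedBall 0 1`, with sup `1^(k−k′)·gen` — for the birth generation the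
SHARP bound `3·gC` of the linear map on the slice domain `closedBall 0 (1 + 1/‖d‖)`. [folklore] -/
theorem hsl_C (K : ℕ) : ∀ (b : (BC K).Birth) (k' k : ℕ), (BC K).birthScale b ≤ k' → k' ≤ k → k ≤ (BC K).K →
    RanBelow (budgetGate (TC K) (fun _ _ => (0 : ℝ)) (1 / 2) (SC K) (4 * 1 / 1) (fun _ : ℕ => ((2 : ℝ) ^ 2)⁻¹ * 1)) k →
    BirthSlice (FnC K b k' k) (fun U d t => U + t * d) (fun d : ℂ => ‖d‖) (closedBall (0 : ℂ) 1) 1 1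
      ((1 : ℝ) ^ (k - k') * (TC K).gen b k') := by
  intro b k' k _ _ _ _ U hU d hd hdw
  rw [one_pow, one_mul]
  show ∃ Dm : Set ℂ, DifferentiableOn ℂ (fun t : ℂ => FnC K b k' k (U + t * d)) Dm ∧
      (∀ t ∈ Dm, ‖FnC K b k' k (U + t * d)‖ ≤ (if k' = b.val then 3 * gC K b.val else 0)) ∧
      ∀ s ∈ Set.Icc (0 : ℝ) 1, closedBall (s : ℂ) (1 / ‖d‖) ⊆ Dm
  by_cases hk' : k' = b.val
  · refine ⟨closedBall (0 : ℂ) (1 + 1 / ‖d‖), ?_, ?_, ?_⟩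
    · unfold FnC
      simp only [if_pos hk']
      exact ((differentiable_const _).mul ((differentiable_const _).add
        (differentiable_id.mul (differentiable_const _)))).differentiableOn
    · intro t ht
      rw [if_pos hk']
      unfold FnC
      rw [if_pos hk', norm_mul, Complex.norm_real, Real.norm_of_nonneg (gC_pos K b.val).le, mul_comm]
      refine mul_le_mul_of_nonneg_right ?_ (gC_pos K b.val).le
      have htd : ‖t‖ * ‖d‖ ≤ (1 + 1 / ‖d‖) * ‖d‖ :=
        mul_le_mul_of_nonneg_right (mem_closedBall_zero_iff.mp ht) (norm_nonneg d)
      rw [add_mul, one_mul, one_div, inv_mul_cancel₀ hd.ne'] at htd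
      calc ‖U + t * d‖ ≤ ‖U‖ + ‖t‖ * ‖d‖ := (norm_add_le _ _).trans (by rw [norm_mul])
        _ ≤ 1 + (‖d‖ + 1) := add_le_add (mem_closedBall_zero_iff.mp hU) htd
        _ ≤ 3 := by linarith
    · intro s hs t ht
      rw [mem_closedBall, dist_eq_norm] at ht
      have h2 : ‖(s : ℂ)‖ ≤ 1 := by rw [Complex.norm_real, Real.norm_of_nonneg hs.1]; exact hs.2
      rw [mem_closedBall_zero_iff]
      calc ‖t‖ = ‖t - (s : ℂ) + (s : ℂ)‖ := by rw [sub_add_cancel]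
        _ ≤ ‖t - (s : ℂ)‖ + ‖(s : ℂ)‖ := norm_add_le _ _
        _ ≤ 1 / ‖d‖ + 1 := add_le_add ht h2
        _ = 1 + 1 / ‖d‖ := add_comm _ _
  · refine ⟨Set.univ, ?_, ?_, fun _ _ => Set.subset_univ _⟩
    · unfold FnC
      simp only [if_neg hk']
      exact differentiableOn_const 0
    · intro t _
      unfold FnC
      simp [hk']

/-- (F-6′ ∕ (VAL-θ) slot) `hrate` with EQUALITY: the defect is `c_δ·((L²)⁻¹)^(k−k′)` at `c_δ = 1`, `L = 2`. [folklore] -/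
theorem hrate_C (K : ℕ) : ∀ (b : (BC K).Birth) (k' k : ℕ), (BC K).birthScale b ≤ k' → k' ≤ k → k ≤ (BC K).K →
    defC k' k ≤ 1 * (((2 : ℝ) ^ 2)⁻¹) ^ (k - k') := by
  intro b k' k _ _ _
  unfold defC
  norm_num

/-- `hdefw`: every defect is inside the window `1`. [folklore] -/
theorem hdefw_C (k' k : ℕ) : defC k' k ≤ 1 := by
  unfold defC
  exact pow_le_one₀ (by norm_num) (by norm_num)

/-- (F-8) `hlin` ATTAINED: the booked size of generation `(b, k′)` at scale `k` is realised — with NO slack — by the fresh pair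
`U₀ = 0 ∈ closedBall 0 1`, `U₁ = 0 + 1·defC k′ k` (a real direction of norm exactly the defect). [folklore] -/
theorem hlin_C (K : ℕ) : ∀ (b : (BC K).Birth) (k' k : ℕ), (BC K).birthScale b ≤ k' → k' ≤ k → k ≤ (BC K).K →
    RanBelow (budgetGate (TC K) (fun _ _ => (0 : ℝ)) (1 / 2) (SC K) (4 * 1 / 1) (fun _ : ℕ => ((2 : ℝ) ^ 2)⁻¹ * 1)) k →
    ∀ ε > 0, ∃ U₀ ∈ closedBall (0 : ℂ) 1, ∃ U₁ : ℂ,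
      RelGauge (fun U U' : ℂ => U = U') (fun U d t => U + t * d) (fun d : ℂ => ‖d‖) U₀ U₁ (defC k' k) ∧
        (TC K).lin b k' k ≤ ‖FnC K b k' k U₁ - FnC K b k' k U₀‖ + ε := by
  intro b k' k _ _ _ _ ε hε
  have hnorm : ‖(defC k' k : ℂ)‖ = defC k' k := by
    rw [Complex.norm_real, Real.norm_of_nonneg (defC_pos k' k).le]
  refine ⟨0, mem_closedBall_self zero_le_one, 0 + 1 * (defC k' k : ℂ),
    ⟨(defC k' k : ℂ), by show 0 < ‖(defC k' k : ℂ)‖; rw [hnorm]; exact defC_pos k' k,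
      by show ‖(defC k' k : ℂ)‖ ≤ defC k' k; rw [hnorm], rfl⟩, ?_⟩
  show (if k' = b.val then sizeC K b.val k else 0) ≤ ‖FnC K b k' k (0 + 1 * (defC k' k : ℂ)) - FnC K b k' k 0‖ + ε
  by_cases hk' : k' = b.val
  · rw [if_pos hk', zero_add, one_mul, hk', ← linC_eq_response K b k]
    exact le_add_of_nonneg_right hε.le
  · rw [if_neg hk']
    positivity

/-- `hinv`: the carried functions are invariant under the (trivial) relation `=`. [folklore] -/
theorem hinv_C (K : ℕ) (b : (BC K).Birth) (k' k : ℕ) : GaugeInvariant (fun U U' : ℂ => U = U') (FnC K b k' k) :=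
  fun _ _ h => by rw [h]

/-- (w1)+(w5b) `hbirth` with EQUALITY at every birth scale: `C·gen b b = 4·3·gC K b = (1/8)^(K−b) = twoRate 1 ρ₁ (1/8) K b b` — the
births sit EXACTLY on the class (history-free births meet `BirthsFromOld` outright). [folklore] -/
theorem hbirth_C (K : ℕ) : (TC K).BirthsFromOld (4 * 1 / 1) (fun _ : ℕ => ((2 : ℝ) ^ 2)⁻¹ * 1)
    (twoRate 1 (rhoOneOf ((2 : ℝ) ^ 2)⁻¹ 1 (4 * 1 / 1) 0) ((2 : ℝ)⁻¹ ^ 3) (BC K).K)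
    (budgetGate (TC K) (fun _ _ => (0 : ℝ)) (1 / 2) (SC K) (4 * 1 / 1) (fun _ : ℕ => ((2 : ℝ) ^ 2)⁻¹ * 1)) := by
  intro b _ _ _
  show 4 * 1 / 1 * (if b.val = b.val then 3 * gC K b.val else 0) ≤
    twoRate 1 (rhoOneOf ((2 : ℝ) ^ 2)⁻¹ 1 (4 * 1 / 1) 0) ((2 : ℝ)⁻¹ ^ 3) K b.val b.val
  rw [if_pos rfl]
  unfold twoRate gC
  have hx : (0 : ℝ) ≤ (1 / 8 : ℝ) ^ (K - b.val) := by positivity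
  norm_num
  linarith

/-- (w5) `hreg`: births only — later generations are absent, so regeneration holds with the constant `0` ((w5) is IDLE on this toy).
[folklore] -/
theorem hreg_C (K : ℕ) : (TC K).RegeneratesFromVar (fun _ : ℕ => (0 : ℝ))
    (budgetGate (TC K) (fun _ _ => (0 : ℝ)) (1 / 2) (SC K) (4 * 1 / 1) (fun _ : ℕ => ((2 : ℝ) ^ 2)⁻¹ * 1)) := by
  intro b k hbk _ _
  show (if k + 1 = b.val then 3 * gC K b.val else 0) ≤ 0 * sizeC K b.val k
  have hne : k + 1 ≠ b.val := by
    change b.val ≤ k at hbk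
    omega
  rw [if_neg hne, zero_mul]

/-- (w3-book) `hS`: live families are born. [folklore] -/
theorem hS_C (K : ℕ) : ∀ k (b : (BC K).Birth), ∀ f ∈ SC K k b, (BC K).birthScale f ≤ k :=
  fun _ _ _ hf => (Finset.mem_filter.mp hf).2

/-- At most ONE family has a given birth scale, so any scale-`j` fibre is counted by `1 ≤ 1·(L⁴)^n`. [folklore] -/
theorem card_fibre_le (K : ℕ) (s : Finset (Fin (K + 1))) (j n : ℕ) :
    (((s.filter fun f => (BC K).birthScale f = j).card : ℝ)) ≤ 1 * ((2 : ℝ) ^ 4) ^ n := by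
  have h : ((s.filter fun f => (BC K).birthScale f = j).card : ℝ) ≤ 1 := by
    have h1 : (s.filter fun f => (BC K).birthScale f = j).card ≤ 1 := by
      refine Finset.card_le_one.mpr fun f hf f' hf' => Fin.ext ?_
      have e : f.val = j := (Finset.mem_filter.mp hf).2
      have e' : f'.val = j := (Finset.mem_filter.mp hf').2
      exact e.trans e'.symm
    exact_mod_cast h1
  exact h.trans (by simpa using one_le_pow₀ (M₀ := ℝ) (a := (2 : ℝ) ^ 4) (n := n) (by norm_num))

/-- (w3-book) `hcount` NON-VACUOUSLY: the live set of a step-`k` component has EXACTLY one member per birth scale `j ≤ k`, so the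
count is `≤ 1 ≤ N₀·(L⁴)^(k−j)` at `N₀ = 1`, `L = 2`. [folklore] -/
theorem hcount_C (K : ℕ) : ∀ k (b : (BC K).Birth), ∀ j ≤ k,
    ((((SC K k b).filter fun f => (BC K).birthScale f = j).card : ℝ)) ≤ 1 * ((2 : ℝ) ^ 4) ^ (k - j) :=
  fun k b j _ => card_fibre_le K (SC K k b) j (k - j)

/-- The bookings' POSITIONAL COUNT at rate `L⁴ = 16`, multiplicity `N₀ = 1` (for ROOT-B): one birth of each scale is felt at each
cube. [folklore] -/
theorem positionalCount_C (K : ℕ) : (BC K).PositionalCount fun j k => 1 * ((2 : ℝ) ^ 4) ^ (k - j) :=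
  fun q j => card_fibre_le K ((BC K).feltAt q) j ((BC K).cubeScale q - j)

/-! ## §3 The END: the composition face of record fires at `L = 2` -/

/-- **THE CELL AT `L = 2`, DECIDED** [decided numerals of the toy]: `locOf 2 1 4 0 = 1/2` (so `≤ ρ′ = 1/2 < 1`), N0e's
`one_lt_of_composition_cell` conclusion `1 < 2 ∧ 2·4·0 < 1`, and the (w6) window `(1/2)·(1·1·(1 − 1/2)⁻¹) ≤ 1 − 0` — TIGHT.
No `e³`. [folklore] -/
theorem cell_at_two :
    locOf 2 1 (4 * 1 / 1) 0 = 1 / 2 ∧ ((1 : ℝ) < 2 ∧ (2 : ℝ) * (4 * 1 / 1) * 0 < 1) ∧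
      (1 / 2 : ℝ) * (1 * 1 * (1 - 1 / 2)⁻¹) ≤ 1 - 0 := by
  refine ⟨by unfold locOf; norm_num, ?_, by norm_num⟩
  exact one_lt_of_composition_cell (ρ' := 1 / 2) (by norm_num) (by norm_num) le_rfl (by unfold locOf; norm_num)
    (by norm_num)

/-- **THE COMPOSITION FACE OF RECORD FIRES AT THE INTEGER `L = 2` — ROOT-C OF RECORD ON THE DATUM** [decided toy]:
`DressedStabilityStrict towerC ((2:ℝ)^4)` = `DressedRootComposition.dressedStabilityStrict_of_composition` BY NAME, ONE
application, at `L = 2, a = 1, c_δ = r = w = 1, c̄ = 0, N₀ = A₀ = 1, m = 1/2, s̄⁰ = 0, ρ′ = 1/2`, every binder discharged by §2 —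
the deterministic ones (`hsl_C`, `hrate_C`, `hlin_C`) and the births (`hbirth_C`) NON-VACUOUSLY.  Λ PIN: `Λ = L^4 = 16` displayed.
Nothing of Bałaban's. [folklore] -/
theorem dressedStabilityStrict_towerC : DressedStabilityStrict towerC ((2 : ℝ) ^ 4) :=
  dressedStabilityStrict_of_composition towerC (L := 2) (a := 1) (cδ := 1) (cbar := 0) (N₀ := 1) (A₀ := 1) (m := 1 / 2)
    (sbar := 0) (ρ' := 1 / 2) (move := fun U d t : ℂ => U + t * d) (N := fun d : ℂ => ‖d‖) (w := 1) (r := 1)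
    (by norm_num) zero_le_one zero_le_one one_pos le_rfl zero_le_one zero_le_one (by norm_num)
    (by unfold locOf; norm_num) (by norm_num) (by norm_num)
    (fun _ _ _ => 0) (fun _ _ _ _ => 0) (fun _ K => SC K)
    (fun _ _ _ => le_rfl) (fun _ _ _ _ => le_rfl) (fun _ K => hS_C K) (fun _ K => hcount_C K) (fun _ _ _ _ => le_rfl)
    (fun _ K => hbirth_C K) (fun _ K => hreg_C K)
    (fun _ K => FnC K) (fun _ _ _ _ U U' => U = U') (fun _ _ _ _ => closedBall (0 : ℂ) 1) (fun _ _ _ k' k => defC k' k)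
    (fun _ K => hinv_C K) (fun _ K => hsl_C K) (fun U d => by simp) (fun _ _ _ k' k => hdefw_C k' k)
    (fun _ K => hrate_C K) (fun _ K => hlin_C K)

/-- **HEADLINE ON THE DATUM** [decided toy]: `DressedStability towerC` (N0e §3 `dressedStability_of_strict_comp` BY NAME). [folklore] -/
theorem dressedStability_towerC : DressedStability towerC :=
  dressedStability_of_strict_comp dressedStabilityStrict_towerC

/-- **ROOT-B ON THE DATUM** [decided toy]: for nonnegative cube weights bounded by `w̄`, `DressedBudget towerC wt` — N0e §3
`dressedBudget_of_strict_comp` BY NAME with the bookings' positional count `1·16^(k−j)` (`positionalCount_C`). [folklore] -/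
theorem dressedBudget_towerC {wt : Unit → ℕ → ℕ → ℝ} {wbar : ℝ} (hwbar : 0 ≤ wbar)
    (hw0 : ∀ p K, ∀ j ≤ K, 0 ≤ wt p K j) (hwb : ∀ p K, ∀ j ≤ K, wt p K j ≤ wbar) :
    DressedBudget towerC wt :=
  dressedBudget_of_strict_comp (L := 2) (N₀ := 1) dressedStabilityStrict_towerC zero_le_one hwbar hw0 hwb
    fun _ K => positionalCount_C K

end Summit.QuantumFields.BalabanUV.T4Continuum.NE1p.DressedCompositionWitness

end
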